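import Mathlib
import Literature.Computability.AlgebraicComplexity.DepthThreeRankBound
import Summits.ValiantsHypothesis.ValiantsHypothesis.Theorems.MonotoneRestorationOrbitRestorationQPSigmaPiSigmaK
import Summits.ValiantsHypothesis.ValiantsHypothesis.Theorems.MonotoneRestorationOrbitRestorationQPRestorable
import Summits.ValiantsHypothesis.ValiantsHypothesis.Theorems.MonotoneRestorationOrbitRestorationQPValueOrbitClosure
import Summits.ValiantsHypothesis.ValiantsHypothesis.Theorems.MonotoneRestorationMixingScaleDefs
import HarnessLib

/-!
# M5 of the line `mixing-scale`: THE ASSEMBLY OF THE NEW RUNG — restoration for GROWING top fan-in (ORBIT currency)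

Route MonotoneRestoration, crux `OrbitRestorationQP` (stmt-ValiantsHypothesis-18293), line `mixing-scale` (val-idea-12, skeleton
`Cruxes/OrbitRestorationQP/Lines/mixing_scale.lean`), registered stub **M5**
`stub_growingFanin : depthThree_rankBound → PiSigmaValue → (∀ c, PolyScaleStructure c) → GrowingFaninRestoration`, landed here BY NAME
as `growingFanin` (same signature) in namespace `Summit.ValiantsHypothesis.ValiantsHypothesis.Theorems.OrbitRestorationQPMixingScale` over
the Theorems-side vocabulary `…MixingScaleDefs.lean` (`PiSigmaValue`, `PolyScaleStructure`, `GrowingFaninRestoration`,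
`GrowingFaninResidual`, bodies verbatim the skeleton's), together with the two PROVED calibrations of the line
(`growingFanin_of_rung`: `A_∞ ⇒` new rung; `boundedFanin_threshold`: constant fan-in meets the growth hypothesis).

THE ARGUMENT (Theorems-side port of the PROVED section `M5` of the skeleton, rev 7, authored by val-idea-12; mirrors the landed assembly
of `stub_sigmaPiSigmaKValue`): (i) UNIFORM FINITE SUMS — a sum of ANY number of `QPOrbitRestorable c` polynomials is
`QPOrbitRestorable (c + 3)` (one value derivation: union + one addition per summand, all partial sums invariant; the landed
`Restorable.qpOrbitRestorable_sum` pays `3` per summand, useless for growing fan-in); (ii) A₁ UNIFORM IN THE LEVEL by the diagonal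
argument (assemble the worst instance of every level into one matrix-symmetric family; every level is restorable with constant `n! + 5`,
so a worst bad constant exists); (iii) the assembly: Theorem S′ at the big levels gives `κ(n)` pieces `u_j · ΠLin_j · Q_j(U)`, uniform A₁
restores the `ΠLin_j`, `Q_j(U)` is restorable, uniform finite sums; small levels cost one constant.

Proved modulo the hypotheses of the stub, which enter BY NAME exactly as registered: `depthThree_rankBound` (unused by the assembly
itself but part of the registered signature), `PiSigmaValue` (A₁, the OPEN `ΠΣ` sub-rung of the line of record) and
`∀ c, PolyScaleStructure c` (Theorem S′ = M4c, OPEN).  Honest framing: nothing here bears on VP ≠ VNP; the rung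
`ProductDepthRestorationQP (fun _ => 1)` is reached only through the declared residual. [cite: DawarWilsenach2025, §3.3]
-/

noncomputable section

open MvPolynomial Equiv Literature.Computability.AlgebraicComplexity

-- `Summit.ValiantsHypothesis.ValiantsHypothesis.…` is the tree's single-conjunct layout (Sub = Summit).
set_option linter.dupNamespace false

namespace Summit.ValiantsHypothesis.ValiantsHypothesis.Theorems.OrbitRestorationQPMixingScale

open RankDistance LevelRep LevelStructure OrbitRestorationQPDepthThreeRung LinNL LinearSubalgebra ProductAction
open Restorable ValueOrbit ValueDerivation PiSigmaClass SigmaPiSigmaK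

/-! ### (i) Uniform finite sums -/
section UniformSum

variable {n : ℕ}

/-- A value derivation containing a finite sum of `QPOrbitRestorable c` polynomials, all of whose members have small orbits (induction on
the number of summands: union of derivations + one addition step; partial sums are invariant). [folklore] -/
theorem exists_derivation_sum {c : ℕ} (hc : 5 ≤ c) : ∀ (m : ℕ) (p : Fin m → MvPolynomial (Fin n × Fin n) ℂ),
    (∀ j, QPOrbitRestorable c n (p j)) →
    (∀ σ : Perm (Fin n), ren σ (∑ j, p j) = ∑ j, p j) ∧
    ∃ 𝒟 : ValueDerivation ℂ (Fin n × Fin n), (∑ j, p j) ∈ 𝒟.S ∧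
      ∀ q ∈ 𝒟.S, (Set.range fun σ : Perm (Fin n) => ren σ q).ncard ≤ 2 ^ ((Nat.log 2 n + c) ^ c) := by
  intro m
  induction m with
  | zero =>
    intro p _
    have h0 : QPOrbitRestorable c n (∑ j : Fin 0, p j) := by
      rw [Finset.univ_eq_empty, Finset.sum_empty, ← C_0]
      exact qpOrbitRestorable_mono hc (qpOrbitRestorable_C 0)
    exact exists_valueDerivation_of_qpOrbitRestorable h0
  | succ m ih =>
    intro p hp
    obtain ⟨hinv1, 𝒟₁, h1, hS1⟩ := ih (fun j => p (Fin.castSucc j)) fun j => hp _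
    obtain ⟨hinv2, 𝒟₂, h2, hS2⟩ := exists_valueDerivation_of_qpOrbitRestorable (hp (Fin.last m))
    rw [Fin.sum_univ_castSucc]
    have hfix : ∀ σ : Perm (Fin n), ren σ ((∑ j : Fin m, p (Fin.castSucc j)) + p (Fin.last m)) =
        (∑ j : Fin m, p (Fin.castSucc j)) + p (Fin.last m) := fun σ => by rw [map_add, hinv1, hinv2]
    refine ⟨hfix, (𝒟₁.union 𝒟₂).addStep _ _ (mem_union_S_left h1) (mem_union_S_right h2),
      mem_addStep_S.2 (Or.inl rfl), ?_⟩
    intro r hr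
    rcases mem_addStep_S.1 hr with rfl | hr
    · exact (ncard_orbit_of_invariant hfix).trans Nat.one_le_two_pow
    rcases mem_union_S.1 hr with hr | hr
    · exact hS1 r hr
    · exact hS2 r hr

/-- **UNIFORM FINITE SUMS.**  A sum of ANY number of `QPOrbitRestorable c` polynomials is `QPOrbitRestorable (c + 3)` — one value
derivation (union + one addition per summand; all partial sums are invariant), then `qpOrbit_of_valueDerivation` ONCE.
(The landed `Restorable.qpOrbitRestorable_sum` pays `3` per summand, useless for growing fan-in.) [folklore] -/
theorem qpOrbitRestorable_sum_uniform {c : ℕ} (hc : 5 ≤ c) (m : ℕ) (p : Fin m → MvPolynomial (Fin n × Fin n) ℂ)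
    (hp : ∀ j, QPOrbitRestorable c n (p j)) : QPOrbitRestorable (c + 3) n (∑ j, p j) := by
  obtain ⟨hfix, 𝒟, hmem, hS⟩ := exists_derivation_sum hc m p hp
  unfold QPOrbitRestorable
  exact qpOrbit_of_valueDerivation 𝒟 hmem hfix hS

end UniformSum

/-! #### (ii) Uniformisation of A₁ over levels (diagonal argument) -/

/-- **A₁, UNIFORM IN THE LEVEL** (auxiliary statement of this development — equivalent reformulation of the hypothesis `PiSigmaValue`,
see `piSigmaValue_uniform`; no citation exists): for every class constant `c₁` ONE restoration constant serves every matrix-symmetric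
affine product of `≤ n^c₁ + c₁` forms at every level. -/
def PiSigmaValueUniform : Prop :=
  ∀ c₁ : ℕ, ∃ c : ℕ, ∀ (n : ℕ) (L : Multiset (MvPolynomial (Fin n × Fin n) ℂ)),
    (∀ ℓ ∈ L, ℓ.totalDegree ≤ 1) → Multiset.card L ≤ n ^ c₁ + c₁ →
    (∀ σ τ : Perm (Fin n), rename (fun p : Fin n × Fin n => (σ p.1, τ p.2)) L.prod = L.prod) →
    QPOrbitRestorable c n L.prod

/-- **The family version A₁ implies the uniform one** (assemble the worst instance of every level into one family; every level is
restorable with constant `n! + 5`, so the bad constants of a level are bounded and a worst one exists). [folklore] -/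
theorem piSigmaValue_uniform (hA1 : PiSigmaValue) : PiSigmaValueUniform := by
  intro c₁
  by_contra H
  push Not at H
  classical
  -- badness
  let Bad : (n : ℕ) → ℕ → Prop := fun n c => ∃ L : Multiset (MvPolynomial (Fin n × Fin n) ℂ),
      (∀ ℓ ∈ L, ℓ.totalDegree ≤ 1) ∧ Multiset.card L ≤ n ^ c₁ + c₁ ∧
      (∀ σ τ : Perm (Fin n), rename (fun p : Fin n × Fin n => (σ p.1, τ p.2)) L.prod = L.prod) ∧
      ¬ QPOrbitRestorable c n L.prod
  have hBad_lt : ∀ n c, Bad n c → c ≤ n.factorial + 5 := by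
    rintro n c ⟨L, -, -, hsym, hbad⟩
    by_contra hle
    push Not at hle
    refine hbad (qpOrbitRestorable_mono hle.le (qpOrbitRestorable_of_invariant _ fun σ => ?_))
    rw [ren_eq_mact, mact_apply]; exact hsym σ σ
  -- the worst bad constant of a level
  let cn : ℕ → ℕ := fun n => Nat.findGreatest (Bad n) (n.factorial + 5)
  have hcn : ∀ n c, Bad n c → c ≤ cn n := fun n c h => Nat.le_findGreatest (hBad_lt n c h) h
  have hcn_bad : ∀ n, (∃ c, Bad n c) → Bad n (cn n) := fun n ⟨c, h⟩ => Nat.findGreatest_spec (hBad_lt n c h) h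
  -- the family of worst instances
  let f : (n : ℕ) → MvPolynomial (Fin n × Fin n) ℂ := fun n =>
    if h : ∃ c, Bad n c then (Classical.choose (hcn_bad n h)).prod else 1
  have hf_bad : ∀ n (h : ∃ c, Bad n c), f n = (Classical.choose (hcn_bad n h)).prod := fun n h => by
    simp only [f, dif_pos h]
  have hf_good : ∀ n, (¬ ∃ c, Bad n c) → f n = 1 := fun n h => by simp only [f, dif_neg h]
  have hsym : IsMatrixSymmetric f := by
    intro n σ τ
    by_cases h : ∃ c, Bad n c
    · rw [hf_bad n h]; exact (Classical.choose_spec (hcn_bad n h)).2.2.1 σ τ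
    · rw [hf_good n h, map_one]
  have hhyp : ∃ c : ℕ, ∀ n : ℕ, PDClass (fun _ => 1) n c (f n) ∧
      ∃ (a : ℂ) (L : Multiset (MvPolynomial (Fin n × Fin n) ℂ)),
        (∀ ℓ ∈ L, ℓ.totalDegree ≤ 1) ∧ Multiset.card L ≤ n ^ c + c ∧ f n = MvPolynomial.C a * L.prod := by
    refine ⟨4 * c₁ + 8, fun n => ?_⟩
    by_cases h : ∃ c, Bad n c
    · obtain ⟨h1, h2, -, -⟩ := Classical.choose_spec (hcn_bad n h)
      rw [hf_bad n h]
      exact ⟨pdClass_one_affineProd _ h1 h2, 1, _, h1, h2.trans (vsbr_pbound_mono (by omega) n), by rw [C_1, one_mul]⟩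
    · rw [hf_good n h]
      refine ⟨?_, 1, 0, by simp, by simp, by simp⟩
      have := pdClass_one_affineProd (n := n) (c := c₁) (0 : Multiset (MvPolynomial (Fin n × Fin n) ℂ)) (by simp) (by simp)
      simpa using this
  obtain ⟨cstar, hcstar⟩ := hA1 f hsym hhyp
  obtain ⟨n, L, h1, h2, h3, hbad⟩ := H cstar
  have hB : Bad n cstar := ⟨L, h1, h2, h3, hbad⟩
  have hex : ∃ c, Bad n c := ⟨cstar, hB⟩
  have hworst := (Classical.choose_spec (hcn_bad n hex)).2.2.2
  refine hworst (qpOrbitRestorable_mono (hcn n cstar hB) ?_)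
  rw [← hf_bad n hex]; exact hcstar n

/-! #### (iii) The assembly -/

/-- **M5 PROVED — RESTORATION FOR GROWING TOP FAN-IN** from A₁ and Theorem S′: structure data at the big levels (`κ(n)` pieces
`u_j · ΠLin_j · Q_j(U)`), uniform A₁ on the `ΠLin_j`, `Q_j(U)` restorable, UNIFORM finite sums; small levels cost one constant. -/
theorem growingFanin (_hRB : depthThree_rankBound) (hA1 : PiSigmaValue) (hS : ∀ c : ℕ, PolyScaleStructure c) :
    GrowingFaninRestoration := by
  intro c
  classical
  obtain ⟨A, hA⟩ := hS c
  obtain ⟨cU, hcU⟩ := piSigmaValue_uniform hA1 c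
  refine ⟨A, fun κ f hsym hthr hf => ?_⟩
  obtain ⟨n₀, hn₀⟩ := hthr
  have hdata : ∀ n, n₀ ≤ n → ∃ (u : Fin (κ n) → ℂ) (Lin : Fin (κ n) → Multiset (MvPolynomial (Fin n × Fin n) ℂ))
      (Q : Fin (κ n) → Polynomial ℂ),
      (∀ j, ∀ q ∈ Lin j, q.totalDegree ≤ 1) ∧ (∀ j, Multiset.card (Lin j) ≤ n ^ c + c) ∧
      (∀ j (σ τ : Perm (Fin n)), rename (fun p : Fin n × Fin n => (σ p.1, τ p.2)) (Lin j).prod = (Lin j).prod) ∧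
      f n = ∑ j, C (u j) * (Lin j).prod * Polynomial.aeval (U n) (Q j) := by
    intro n hn
    obtain ⟨-, a, L, hL, hcard, hfn⟩ := hf n
    exact hA (κ n) n (hn₀ n hn) (f n) (hsym n) a L hL hcard hfn
  choose u Lin Q hLin1 hLin2 hLin3 hfsum using hdata
  set cA : ℕ := max cU 5 with hcA
  have hbig : ∀ n, n₀ ≤ n → QPOrbitRestorable (cA + 9) n (f n) := by
    intro n hn
    rw [hfsum n hn]
    refine qpOrbitRestorable_sum_uniform (c := cA + 6) (by omega) (κ n)
      (fun j => C (u n hn j) * (Lin n hn j).prod * Polynomial.aeval (U n) (Q n hn j)) fun j => ?_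
    have h1 : QPOrbitRestorable cA n (Lin n hn j).prod :=
      qpOrbitRestorable_mono (le_max_left _ _) (hcU n (Lin n hn j) (hLin1 n hn j) (hLin2 n hn j) (hLin3 n hn j))
    have h2 : QPOrbitRestorable cA n (Polynomial.aeval (U n) (Q n hn j)) :=
      qpOrbitRestorable_mono (le_max_right _ _) (qpOrbitRestorable_aeval_U _)
    have h3 := ValueOrbit.qpOrbitRestorable_smul (u n hn j) (ValueOrbit.qpOrbitRestorable_mul h1 h2)
    rw [← mul_assoc] at h3
    exact h3
  have hsmall : ∀ n, n < n₀ → QPOrbitRestorable (n₀.factorial + 5) n (f n) := fun n hn =>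
    qpOrbitRestorable_mono (Nat.add_le_add_right (Nat.factorial_le hn.le) 5)
      (qpOrbitRestorable_of_invariant (f n) (ren_eq_of_matrixSymmetric hsym n))
  refine ⟨max (cA + 9) (n₀.factorial + 5), fun n => ?_⟩
  by_cases hn : n₀ ≤ n
  · exact qpOrbitRestorable_mono (le_max_left _ _) (hbig n hn)
  · exact qpOrbitRestorable_mono (le_max_right _ _) (hsmall n (not_le.1 hn))



/-! ### Calibration (proved): the new rung sits between `⋀_k A_k` and `A_∞` -/

/-- ON-PATH: the rung `A_∞ = ProductDepthRestorationQP (fun _ => 1)` implies the new rung (it asks for less: no representation data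
at all). [folklore] -/
theorem growingFanin_of_rung (h : ProductDepthRestorationQP (fun _ => 1)) : GrowingFaninRestoration := by
  intro c
  refine ⟨0, fun κ f hsym _ hrep => ?_⟩
  exact h f hsym ⟨c, fun n => (hrep n).1⟩

/-- REAL STEP ABOVE EVERY A_k: for CONSTANT fan-in `κ ≡ k` the growth hypothesis of `GrowingFaninRestoration` holds (so the new
rung specialises to the hypothesis class of each landed A_k, uniformly in `k`). [folklore] -/
theorem boundedFanin_threshold (B k : ℕ) :
    ∃ n₀ : ℕ, ∀ n : ℕ, n₀ ≤ n → B * (k + 1) ^ 7 * (Nat.log 2 n + 1) ≤ n := by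
  refine ⟨max 1 (4 * (B * (k + 1) ^ 7) ^ 2), fun n hn => ?_⟩
  have h1 : 1 ≤ n := le_trans (le_max_left _ _) hn
  have h4 : 4 * (B * (k + 1) ^ 7) ^ 2 ≤ n := le_trans (le_max_right _ _) hn
  exact SigmaKThresholds.linear_log_le h4 h1

/-- **The line's reduction, Theorems-side**: the new rung `GrowingFaninRestoration` from the two NAMED FACTS (product mixing in `𝔄_n`,
the Saxena–Seshadhri rank bound), A₁ by name, and Theorem S′ (M4c, OPEN) — with M2 (`stub_almostInvariantTerms`), M3
(`stub_orbitClassSums`), M4a (`essStableAlt`), M4b (`spanOneUAlt`) already landed, the only open input below Theorem S′ is M4c itself.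
[folklore] -/
theorem growingFanin_of_polyScaleStructure (hRB : depthThree_rankBound) (hA1 : PiSigmaValue)
    (hS : ∀ c : ℕ, PolyScaleStructure c) : GrowingFaninRestoration :=
  growingFanin hRB hA1 hS

end Summit.ValiantsHypothesis.ValiantsHypothesis.Theorems.OrbitRestorationQPMixingScale

end
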